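import Summits.QuantumFields.GaugeBoot.WordEdgesZ
import HarnessLib

/-!
# Gauge-boot: a kernel-decidable checker for the torus hypotheses of the Bessel cap, uniformly in the torus size

Cell `ym-instrument` (HOME `run/shared/lean/pub/ym-instrument/`), crew (a), seat `ym-instrument-boot-lean-1`;
A-plan-11 «BESSEL CAP» typing, file 8 (the per-row binding tool). Builds on `WordEdgesZ` (count / share transfer).

HONEST FRAMING (page 1 of every file of this cell): pure combinatorics of lattice words; nothing is certified about any
lattice gauge theory at any `(G, D, L, β)`; nothing summit-bearing.

## Content

`capCheck w FZ L₀ : Bool` decides, from the WORD `w` (read from the origin), a list `FZ` of `ℤ^d`-links and a threshold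
`L₀`, the data of the Bessel cap for EVERY torus `(ℤ/L)^d` with `L ≥ L₀`:
`2 ≤ L₀`; `FZ` has no duplicates; every link of `FZ` is read EXACTLY ONCE by `w` on `ℤ^d`; no two distinct links of `FZ`
share a `ℤ^d` plaquette (`ShareZ`); and the word is SMALL for `L₀`: any two read links are within sup-distance `L₀ - 3`
(so nothing wraps). `capCheck_sound`: on every torus `L ≥ L₀` the cast links `F = castEdge x '' FZ` form an admissible set
of the source theorem `GaugeBoot.abs_wilsonExpectation_wordLoop_le_pow` — `|F| = |FZ|`, once-read, pairwise no common
plaquette — at every base point `x`. One `decide` per certificate row (word, witness list) then yields the «| cap» box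
`|y_v| ≤ ρ^{|FZ|}` for all `L ≥ L₀` (files `YangMills/Theorems/Instrument/BesselCapSU2D4`, `…/BesselCapRows`).
-/

namespace Summit.QuantumFields.GaugeBoot

open Literature.MathematicalPhysics.QuantumFieldTheory

variable {d L : ℕ}

/-- The SPREAD condition: any two `ℤ^d`-links read by `w` (from `0`) are within sup-distance `L₀ - 3`. [folklore] -/
def Word.SpreadOK (w : Word d) (L₀ : ℕ) : Prop :=
  ∀ E ∈ Word.edgesReadZ 0 w, ∀ E' ∈ Word.edgesReadZ 0 w, ∀ k : Fin d, (E.1 k - E'.1 k).natAbs + 3 ≤ L₀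

/-- `SpreadOK` is decidable (finite lists, finitely many coordinates). [folklore] -/
instance Word.SpreadOK.decidable (w : Word d) (L₀ : ℕ) : Decidable (w.SpreadOK L₀) := by
  unfold Word.SpreadOK; infer_instance

/-- **THE CHECKER** for a cap witness: threshold `≥ 2`, no duplicate links, each link read exactly once on `ℤ^d`, pairwise
no common `ℤ^d` plaquette, and the spread condition. Kernel-decidable on explicit data. [folklore] -/
def capCheck (w : Word d) (FZ : List (EdgeZ d)) (L₀ : ℕ) : Bool :=
  decide (2 ≤ L₀) && decide FZ.Nodup && decide (∀ E ∈ FZ, (Word.edgesReadZ 0 w).count E = 1) &&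
    decide (∀ E ∈ FZ, ∀ E' ∈ FZ, E ≠ E' → ¬ ShareZ E E') && decide (w.SpreadOK L₀)

/-- The admissible torus link set produced by a witness: the casts of the `ℤ^d`-links, seen from the base point `x`.
[folklore] -/
noncomputable def capLinks (x : Site d L) (FZ : List (EdgeZ d)) : Finset (Edge d L) := by
  classical exact (FZ.map (castEdge x)).toFinset

/-- Unpacking the checker. [folklore] -/
theorem capCheck_spec {w : Word d} {FZ : List (EdgeZ d)} {L₀ : ℕ} (h : capCheck w FZ L₀ = true) :
    2 ≤ L₀ ∧ FZ.Nodup ∧ (∀ E ∈ FZ, (Word.edgesReadZ 0 w).count E = 1) ∧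
      (∀ E ∈ FZ, ∀ E' ∈ FZ, E ≠ E' → ¬ ShareZ E E') ∧ w.SpreadOK L₀ := by
  simp only [capCheck, Bool.and_eq_true, decide_eq_true_eq] at h
  exact ⟨h.1.1.1.1, h.1.1.1.2, h.1.1.2, h.1.2, h.2⟩

/-- A link read exactly once is read. [folklore] -/
theorem mem_edgesReadZ_of_count_eq_one {w : Word d} {E : EdgeZ d} (h : (Word.edgesReadZ 0 w).count E = 1) :
    E ∈ Word.edgesReadZ 0 w :=
  List.count_pos_iff.1 (by omega)

/-- The spread condition gives the two smallness hypotheses of the transfer lemmas on every torus `L ≥ L₀`. [folklore] -/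
theorem Word.SpreadOK.abs_lt {w : Word d} {L₀ : ℕ} (h : w.SpreadOK L₀) (hL : L₀ ≤ L) {E E' : EdgeZ d}
    (hE : E ∈ Word.edgesReadZ 0 w) (hE' : E' ∈ Word.edgesReadZ 0 w) (k : Fin d) :
    |E.1 k - E'.1 k| + 2 < L := by
  have h1 := h E hE E' hE' k
  have h2 : ((E.1 k - E'.1 k).natAbs : ℤ) = |E.1 k - E'.1 k| := Int.natCast_natAbs _
  have h3 : ((E.1 k - E'.1 k).natAbs : ℤ) + 3 ≤ (L₀ : ℤ) := by exact_mod_cast h1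
  have h4 : (L₀ : ℤ) ≤ L := by exact_mod_cast hL
  omega

/-- **SOUNDNESS OF THE CHECKER.** If `capCheck w FZ L₀ = true`, then on every torus `(ℤ/L)^d` with `L ≥ L₀` and at every base
point `x`: `1 < L`, the cast link set `capLinks x FZ` has exactly `|FZ|` elements, the word `w` read from `x` traverses each of
its links exactly once, and no two distinct links of it are read by a common plaquette — the hypotheses of
`abs_wilsonExpectation_wordLoop_le_pow`. [folklore] -/
theorem capCheck_sound {w : Word d} {FZ : List (EdgeZ d)} {L₀ : ℕ} (h : capCheck w FZ L₀ = true) (hL : L₀ ≤ L)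
    [NeZero L] (x : Site d L) :
    1 < L ∧ (capLinks x FZ).card = FZ.length ∧
      (∀ e ∈ capLinks x FZ, (Word.edgesRead x w).count e = 1) ∧
      (∀ e ∈ capLinks x FZ, ∀ e' ∈ capLinks x FZ, e ≠ e' → ¬ SharePlaquette e e') := by
  classical
  obtain ⟨h2, hnd, hcnt, hsh, hsp⟩ := capCheck_spec h
  have hmem : ∀ E ∈ FZ, E ∈ Word.edgesReadZ 0 w := fun E hE => mem_edgesReadZ_of_count_eq_one (hcnt E hE)
  -- injectivity of the cast on the read links
  have hinj : ∀ E ∈ Word.edgesReadZ 0 w, ∀ E' ∈ Word.edgesReadZ 0 w, castEdge x E = castEdge x E' → E = E' :=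
    fun E hE E' hE' hc => eq_of_castEdge_eq x (fun k => by have := hsp.abs_lt hL hE hE' k; omega) hc
  have hcap : ∀ e, e ∈ capLinks x FZ ↔ ∃ E ∈ FZ, castEdge x E = e := by
    intro e
    unfold capLinks
    rw [List.mem_toFinset, List.mem_map]
  refine ⟨by omega, ?_, ?_, ?_⟩
  · unfold capLinks
    rw [List.toFinset_card_of_nodup, List.length_map]
    exact hnd.map_on fun E hE E' hE' hc => hinj E (hmem E hE) E' (hmem E' hE') hc
  · intro e he
    obtain ⟨E, hE, rfl⟩ := (hcap e).1 he
    rw [Word.count_edgesRead_castEdge x w E (fun E' hE' k => by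
      have := hsp.abs_lt hL hE' (hmem E hE) k; omega)]
    exact hcnt E hE
  · intro e he e' he' hne hshare
    obtain ⟨E, hE, rfl⟩ := (hcap e).1 he
    obtain ⟨E', hE', rfl⟩ := (hcap e').1 he'
    have hEE : E ≠ E' := fun hEq => hne (by rw [hEq])
    exact hsh E hE E' hE' hEE
      (shareZ_of_sharePlaquette x (fun k => hsp.abs_lt hL (hmem E hE) (hmem E' hE') k) hshare)

end Summit.QuantumFields.GaugeBoot
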